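import Literature.Topology.Immersions.NormalProjBundle
import HarnessLib

/-!
# Projection-field bundles: pull-backs, and the tangent bundle of an immersion

Topic `Literature/Topology/Immersions`; basic constructions on the tree's projection-field
bundles (`ProjectionFieldBundle.lean`, Milnor–Stasheff, *Characteristic Classes* (1974), §3):

* `ProjBundle.pullback P φ hφ` — the **pull-back** `φ^*E` of `E = E(P)` over `M` along a `C^∞`
  map `φ : N → M`: the projection field `y ↦ P_{φ y}` (Milnor–Stasheff §3, p. 26, induced
  bundles; here literally the same fibres over the new base); `fibre_pullback`;
* `ProjBundle.tangent hf himm` — the **tangent bundle of an immersion** `f : M → ℝ^q` as the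
  field of orthogonal projections onto `df(T_x M)` (the tree's
  `Literature.Topology.FourManifolds.tangentProj`, smooth by `contMDiff_tangentProj`), of rank
  `n`; `fibre_tangent` (`= tangentPlane`), and the complementarity with the normal bundle of
  `NormalProjBundle.lean`: `tangent_proj_add_normal_proj` (`P^{tan}_x + P^{nor}_x = 1`),
  `fibre_normal_eq_orthogonal_fibre_tangent`.

Everything here is proved; no named facts are introduced.

## References

* J. Milnor, J. Stasheff, *Characteristic Classes* (1974), §3 (induced bundles p. 26; tangent
  and normal bundles of an immersion, Thm. 3.3 ff.). [MilnorStasheff1974]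
-/

open scoped Manifold ContDiff Topology RealInnerProductSpace
open Set Function Module

noncomputable section

namespace Literature.Topology.Immersions

/-- Local notation: `𝔼 n` is the model Euclidean space `EuclideanSpace ℝ (Fin n)`. -/
local notation "𝔼 " n:arg => EuclideanSpace ℝ (Fin n)

open Literature.Topology.FourManifolds (tangentPlane tangentProj normalSpace contMDiff_tangentProj
  tangentProj_apply_of_mem tangentProj_apply_mem mfderiv_mem_tangentPlane)

namespace ProjBundle

variable {n n' m k q : ℕ} {M : Type*} [TopologicalSpace M] [ChartedSpace (𝔼 n) M]
  {N : Type*} [TopologicalSpace N] [ChartedSpace (𝔼 n') N]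

/-! ### Pull-backs -/

/-- **The pull-back `φ^*E`** of a projection-field bundle along a `C^∞` map `φ : N → M`: the
projection field `y ↦ P_{φ y}`. [cite: MilnorStasheff1974, §3 p. 26] -/
def pullback (P : ProjBundle n m k M) (φ : N → M) (hφ : ContMDiff (𝓡 n') (𝓡 n) ∞ φ) :
    ProjBundle n' m k N where
  proj y := P.proj (φ y)
  contMDiff_proj' := P.contMDiff_proj'.comp hφ
  proj_proj y := P.proj_proj (φ y)
  inner_proj_comm y := P.inner_proj_comm (φ y)
  finrank_range y := P.finrank_range (φ y)

/-- The projections of the pull-back. [folklore] -/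
@[simp] theorem pullback_proj (P : ProjBundle n m k M) (φ : N → M)
    (hφ : ContMDiff (𝓡 n') (𝓡 n) ∞ φ) (y : N) : (P.pullback φ hφ).proj y = P.proj (φ y) := rfl

/-- The fibres of the pull-back are the fibres over the image points. [folklore] -/
theorem fibre_pullback (P : ProjBundle n m k M) (φ : N → M) (hφ : ContMDiff (𝓡 n') (𝓡 n) ∞ φ)
    (y : N) : (P.pullback φ hφ).fibre y = P.fibre (φ y) := rfl

/-! ### The tangent bundle of an immersion -/

variable [IsManifold (𝓡 n) ∞ M]

/-- **The tangent bundle of an immersion `f : M → ℝ^q`** as a projection-field bundle of rank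
`n`: `x ↦` the orthogonal projection onto `df(T_x M)`. [cite: MilnorStasheff1974, §3 Thm. 3.3] -/
def tangent {f : M → 𝔼 q} (hf : ContMDiff (𝓡 n) (𝓡 q) ∞ f)
    (himm : ∀ x, Injective (mfderiv (𝓡 n) (𝓡 q) f x)) : ProjBundle n q n M where
  proj := tangentProj (𝓡 n) f
  contMDiff_proj' := contMDiff_tangentProj (I := 𝓡 n) hf himm
  proj_proj x v := by
    show (tangentPlane (𝓡 n) f x).starProjection ((tangentPlane (𝓡 n) f x).starProjection v) =
      (tangentPlane (𝓡 n) f x).starProjection v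
    rw [Submodule.starProjection_eq_self_iff]
    exact Submodule.starProjection_apply_mem _ v
  inner_proj_comm x v w := Submodule.inner_starProjection_left_eq_right _ v w
  finrank_range x := by
    have h1 : LinearMap.range (tangentProj (𝓡 n) f x).toLinearMap = tangentPlane (𝓡 n) f x :=
      Submodule.range_starProjection _
    rw [h1]
    change finrank ℝ (LinearMap.range (mfderiv (𝓡 n) (𝓡 q) f x).toLinearMap) = n
    rw [LinearMap.finrank_range_of_inj (himm x)]
    exact finrank_euclideanSpace_fin

/-- The projection field of the tangent bundle is `tangentProj`. [folklore] -/
theorem tangent_proj {f : M → 𝔼 q} (hf : ContMDiff (𝓡 n) (𝓡 q) ∞ f)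
    (himm : ∀ x, Injective (mfderiv (𝓡 n) (𝓡 q) f x)) :
    (tangent hf himm).proj = tangentProj (𝓡 n) f := rfl

/-- **The fibre of the tangent bundle is the tangent plane** `df(T_x M)`. [folklore] -/
theorem fibre_tangent {f : M → 𝔼 q} (hf : ContMDiff (𝓡 n) (𝓡 q) ∞ f)
    (himm : ∀ x, Injective (mfderiv (𝓡 n) (𝓡 q) f x)) (x : M) :
    (tangent hf himm).fibre x = tangentPlane (𝓡 n) f x :=
  Submodule.range_starProjection _

/-- Tangent vectors `df_x ξ` lie in the fibre of the tangent bundle. [folklore] -/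
theorem mfderiv_mem_fibre_tangent {f : M → 𝔼 q} (hf : ContMDiff (𝓡 n) (𝓡 q) ∞ f)
    (himm : ∀ x, Injective (mfderiv (𝓡 n) (𝓡 q) f x)) (x : M) (ξ : 𝔼 n) :
    (mfderiv (𝓡 n) (𝓡 q) f x ξ : 𝔼 q) ∈ (tangent hf himm).fibre x := by
  rw [fibre_tangent]
  exact mfderiv_mem_tangentPlane (I := 𝓡 n) f x ξ

/-- **Tangent and normal projections are complementary**: `P^{tan}_x + P^{nor}_x = 1`.
[cite: MilnorStasheff1974, §3 Thm. 3.3] -/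
theorem tangent_proj_add_normal_proj (hk : k + n = q) {f : M → 𝔼 q}
    (hf : ContMDiff (𝓡 n) (𝓡 q) ∞ f) (himm : ∀ x, Injective (mfderiv (𝓡 n) (𝓡 q) f x))
    (x : M) : (tangent hf himm).proj x + (normal hk f hf himm).proj x = 1 := by
  ext1 v
  show tangentProj (𝓡 n) f x v + normalProj n f x v = v
  rw [normalProj_apply]
  abel

/-- **The normal fibre is the orthogonal complement of the tangent fibre.**
[cite: MilnorStasheff1974, §3 Thm. 3.3] -/
theorem fibre_normal_eq_orthogonal_fibre_tangent (hk : k + n = q) {f : M → 𝔼 q}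
    (hf : ContMDiff (𝓡 n) (𝓡 q) ∞ f) (himm : ∀ x, Injective (mfderiv (𝓡 n) (𝓡 q) f x))
    (x : M) : (normal hk f hf himm).fibre x = ((tangent hf himm).fibre x)ᗮ := by
  rw [fibre_normal_eq, fibre_tangent]

end ProjBundle

end Literature.Topology.Immersions
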